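import Summits.Ventures.HSemireg.WedgeHankelKernelColumnSpace
import Summits.Ventures.HSemireg.WedgeHankelNodeImagesLow

/-!
# Venture HSemireg — THE IMAGE TOWER IS GENERATED IN ITS LOWEST DEGREE: for every class `f`, **`V(univ, f, e + a) = Hom(univ, e) ∧ V(univ, f, a)`** (every monomial multiple
# `E_W ∧ f`, `|W| = e + a`, splits as `±E_U ∧ (E_s ∧ f)`), hence **containment of images ASCENDS in degree**: `V(univ, f, a) ⊆ V(univ, g, a) ⇒ V(univ, f, e + a) ⊆ V(univ, g, e + a)`;
# for th-7's classes M14's column-space control in degree `k` therefore governs the images in EVERY degree `j ≥ N − k` (and, N8, the kernels in every degree `≤ k`)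

HONEST FRAMING. Part of the Lean index of the computation cell `pub-hsemireg` (seat p10 gen 25, Sunday typer «UNIFORM-IN-n»).
Finite-dimensional EXTERIOR ALGEBRA over a field ONLY: no variety, no cohomology theory, no sheaf, no Ext group, no semiregularity map; nothing here says that HC / HC_CM / HC_AV holds;
no Literature fact is declared or used.  Custodian versions as in `WedgeHankelSiegelIdeal` (1/3) and `WedgeKernelDuality` (E1); the dictionary (`V(univ, f, a)` = the image of the degree-`a`
forms under `θ ↦ θ ∧ f`; the images in the various degrees as one tower) is QUOTED, never asserted.

WHAT IS IN THE TREE.  `Hom_mul_V_le` (`WedgeHankelNodeImagesLow`: `Hom(univ, e) ∧ V(univ, f, a) ⊆ V(univ, f, e + a)`), `B_mul_B` / `u_ne_zero_iff` (monomial products with their signs),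
G6 `Hom_mul_coSiegel_n` (the same generation statement for the co-Siegel tower), M14 `V_w_mono_of_range_hankel1_le` (column-space control of the image in the mirror degree `N − k`).
THIS FILE (namespace `Summit.Ventures.HSemireg.Wedge.HankelOuter` continued; imports M14 and `WedgeHankelNodeImagesLow`):
* §448 ANY CLASS: **`V_add_eq_Hom_mul_V`** (`V(univ, f, e + a) = Hom(univ, e) ∧ V(univ, f, a)`), **`V_mono_of_le_degree'`** (`V(f, a) ⊆ V(g, a) ⇒ V(f, e + a) ⊆ V(g, e + a)`),
  `V_eq_of_eq_degree'` — no homogeneity or degree bound needed.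
* §449 TH-7's CLASSES: **`V_w_mono_of_le_degree`** (`k ≤ j`: `V(w_N q, k) ⊆ V(w_N q′, k) ⇒ V(w_N q, j) ⊆ V(w_N q′, j)`), `V_w_eq_of_eq_degree`,
  **`V_w_mono_of_range_hankel1_le_of_le`** (`k + k′ = N`, `k′ ≤ j`: `col H_k(q) ⊆ col H_k(q′) ⇒ V(w_N q, j) ⊆ V(w_N q′, j)` — M14's image control propagated UP the tower),
  `V_w_eq_of_range_hankel1_eq_of_le`.
READING: with N8 (kernels: containment descends) the picture is symmetric — the column space `col H_k(q)` of ONE catalecticant controls the kernels in all degrees `≤ k` and the images in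
all degrees `≥ N − k`; the image tower of any class is generated by its bottom piece.  Nothing Ext-side.  New names only.
-/

open Module

namespace Summit.Ventures.HSemireg.Wedge.HankelOuter

open Summit.Ventures.HSemireg.Wedge Summit.Ventures.HSemireg.Wedge.Kunneth Summit.Ventures.HSemireg.Wedge.Hankel
  Summit.Ventures.HSemireg.Wedge.BasisFree Summit.Ventures.HSemireg.Wedge.HankelSiegel Summit.Ventures.HSemireg.Wedge.HankelSiegelIdeal
  Summit.Ventures.HSemireg.Wedge.KunnethKernel Summit.Ventures.HSemireg.Wedge.HankelFrameChange Summit.Ventures.HSemireg.Wedge.KernelDuality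

variable (K : Type*) [Field K]

section General

variable {I : Type*} [LinearOrder I] [Fintype I]

/-! ## §448. Any class: the image tower is generated in its lowest degree -/

/-- **THE IMAGE TOWER IS GENERATED IN ITS LOWEST DEGREE: `V(univ, f, e + a) = Hom(univ, e) ∧ V(univ, f, a)`** for every class `f` and all `e, a` — a monomial multiple `E_W ∧ f` with
`|W| = e + a` splits as `(u)⁻¹ • E_U ∧ (E_s ∧ f)` for any `U ⊆ W` with `|U| = e`, `s = W ∖ U`. -/
theorem V_add_eq_Hom_mul_V (f : HT K I) (e a : ℕ) :
    V K I Finset.univ f (e + a) = Hom K I (Finset.univ : Finset I) e * V K I Finset.univ f a := by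
  refine le_antisymm ?_ (Hom_mul_V_le K e a f)
  rw [V, Submodule.span_le]
  rintro _ ⟨W, ⟨-, hW⟩, rfl⟩
  obtain ⟨U, hUW, hU⟩ := Finset.exists_subset_card_eq (show e ≤ W.card by omega)
  have hdisj : Disjoint U (W \ U) := Finset.disjoint_sdiff
  have hu : u K U (W \ U) ≠ 0 := (u_ne_zero_iff K).mpr hdisj
  have hcard : (W \ U).card = a := by rw [Finset.card_sdiff_of_subset hUW, hW, hU]; omega
  have e1 : B K I W = (u K U (W \ U))⁻¹ • (B K I U * B K I (W \ U)) := by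
    rw [B_mul_B, Finset.union_sdiff_of_subset hUW, smul_smul, inv_mul_cancel₀ hu, one_smul]
  rw [SetLike.mem_coe, show (fun s => B K I s * f) W = B K I W * f from rfl, e1, smul_mul_assoc, mul_assoc]
  refine Submodule.smul_mem _ _ (Submodule.mul_mem_mul (B_mem_Hom K (Finset.subset_univ U) hU) ?_)
  exact Submodule.subset_span ⟨W \ U, ⟨Finset.subset_univ _, hcard⟩, rfl⟩

/-- **CONTAINMENT OF IMAGES ASCENDS IN DEGREE: `V(univ, f, a) ⊆ V(univ, g, a) ⇒ V(univ, f, e + a) ⊆ V(univ, g, e + a)`** (any two classes, every `e`). -/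
theorem V_mono_of_le_degree' {f g : HT K I} {a : ℕ} (e : ℕ) (h : V K I Finset.univ f a ≤ V K I Finset.univ g a) :
    V K I Finset.univ f (e + a) ≤ V K I Finset.univ g (e + a) := by
  rw [V_add_eq_Hom_mul_V K f e a, V_add_eq_Hom_mul_V K g e a]
  exact mul_le_mul_right h _

/-- **equal images in degree `a` ⇒ equal images in every degree `e + a`.** -/
theorem V_eq_of_eq_degree' {f g : HT K I} {a : ℕ} (e : ℕ) (h : V K I Finset.univ f a = V K I Finset.univ g a) :
    V K I Finset.univ f (e + a) = V K I Finset.univ g (e + a) := by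
  rw [V_add_eq_Hom_mul_V K f e a, V_add_eq_Hom_mul_V K g e a, h]

end General

/-! ## §449. th-7's classes: column-space control propagates up the image tower -/

variable {N : ℕ}

/-- **`k ≤ j`: `V(univ, w_N q, k) ⊆ V(univ, w_N q′, k) ⇒ V(univ, w_N q, j) ⊆ V(univ, w_N q′, j)`** (every field, every `N`). -/
theorem V_w_mono_of_le_degree {k j : ℕ} (hkj : k ≤ j) {q q' : ℕ → K}
    (h : V K (In N) Finset.univ (w K N N q) k ≤ V K (In N) Finset.univ (w K N N q') k) :
    V K (In N) Finset.univ (w K N N q) j ≤ V K (In N) Finset.univ (w K N N q') j := by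
  rw [show j = (j - k) + k by omega]
  exact V_mono_of_le_degree' K (j - k) h

/-- **THE DEGREE-`k` IMAGE DETERMINES ALL HIGHER IMAGES: `V(w_N q, k) = V(w_N q′, k) ⇒ V(w_N q, j) = V(w_N q′, j)`** for `k ≤ j`. -/
theorem V_w_eq_of_eq_degree {k j : ℕ} (hkj : k ≤ j) {q q' : ℕ → K}
    (h : V K (In N) Finset.univ (w K N N q) k = V K (In N) Finset.univ (w K N N q') k) :
    V K (In N) Finset.univ (w K N N q) j = V K (In N) Finset.univ (w K N N q') j :=
  le_antisymm (V_w_mono_of_le_degree K hkj h.le) (V_w_mono_of_le_degree K hkj h.ge)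

/-- **M14 PROPAGATED UP THE TOWER: `col H_k(q) ⊆ col H_k(q′) ⇒ V(univ, w_N q, j) ⊆ V(univ, w_N q′, j)` for every `j ≥ N − k`** (`k + k′ = N`, `k′ ≤ j`). -/
theorem V_w_mono_of_range_hankel1_le_of_le {k k' j : ℕ} (hkk' : k + k' = N) (hk'j : k' ≤ j) {q q' : ℕ → K}
    (h : LinearMap.range (hankel1 K N k q).mulVecLin ≤ LinearMap.range (hankel1 K N k q').mulVecLin) :
    V K (In N) Finset.univ (w K N N q) j ≤ V K (In N) Finset.univ (w K N N q') j :=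
  V_w_mono_of_le_degree K hk'j (V_w_mono_of_range_hankel1_le K hkk' h)

/-- **`col H_k(q) = col H_k(q′) ⇒ V(univ, w_N q, j) = V(univ, w_N q′, j)` for every `j ≥ N − k`.** -/
theorem V_w_eq_of_range_hankel1_eq_of_le {k k' j : ℕ} (hkk' : k + k' = N) (hk'j : k' ≤ j) {q q' : ℕ → K}
    (h : LinearMap.range (hankel1 K N k q).mulVecLin = LinearMap.range (hankel1 K N k q').mulVecLin) :
    V K (In N) Finset.univ (w K N N q) j = V K (In N) Finset.univ (w K N N q') j :=
  V_w_eq_of_eq_degree K hk'j (V_w_eq_of_range_hankel1_eq K hkk' h)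

end Summit.Ventures.HSemireg.Wedge.HankelOuter
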